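import Mathlib
import Summits.Ventures.PercRepro2.Defs
import Summits.Ventures.PercRepro2.Graph
import Summits.Ventures.PercRepro2.Induced
import Summits.Ventures.PercRepro2.VdBKahn
import Summits.Ventures.PercRepro2.ReimerVdBK
import Summits.Ventures.PercRepro2.ReimerVdBKRegions
import Summits.Ventures.PercRepro2.ReimerVdBKZClosed
import Summits.Ventures.PercRepro2.ReimerVdBKZReduction
import Summits.Ventures.PercRepro2.ReimerVdBKLeafGadget
import Summits.Ventures.PercRepro2.ReimerVdBKTwisted

/-!
# Harris on a tied sub-cube
(blind cell PercRepro2, mine-c g47; `conjectures/MINE-C.md` §56.7 (b), §56.8)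

The Harris-pair case of (R-1.2) (`rvdBK_of_disjoint`) survives the restriction to the colourings that are CONSTANT
on a set `F` of edges (`tied F`): the tied colourings are the product of the free edges with one coordinate for
the block (`tie`), the map is monotone and commutes with the complement, so the two-world events pull back to
upper sets and the abstract Harris `count_inter_bar_le_count_inter` applies.  THEOREM `count_tied_le`: for
`X ∩ Y = ∅`, `#{ω ∈ L : ω constant on F} ≤ #{ω ∈ R : ω constant on F}`.  This is the TIED CLASS of the
degree-`d` expansion of (CORE↓) at a vertex of degree `d` (the monochromatic star; `MINE-C.md` §56.7 (b), §56.8):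
with `F` the star at an unmarked vertex `v`, `v` is never in the core on a tied colouring, so the inequality is
the class statement.
-/

namespace Summit.Ventures.PercRepro2
namespace ReimerVdBK
open Classical

variable {V : Type*} {E : Type*} [Fintype E] [DecidableEq E] [Fintype V] [DecidableEq V]
variable (ends : E → Sym2 V) (s : V)

omit [Fintype E] [DecidableEq E] [Fintype V] [DecidableEq V] in
/-- The configurations constant on `F`. -/
def tied (F : Finset E) : Set (Config E) := {ω | ∀ e ∈ F, ∀ e' ∈ F, ω e = ω e'}

section Pullback
variable (F : Finset E)

omit [Fintype E] [Fintype V] [DecidableEq V] in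
/-- The tied sub-cube as a product: the free edges and one coordinate for the block. -/
def tie (ω'' : Config ({e : E // e ∉ F} ⊕ Unit)) : Config E :=
  fun e => if h : e ∈ F then ω'' (Sum.inr ()) else ω'' (Sum.inl ⟨e, h⟩)

omit [Fintype E] [Fintype V] [DecidableEq V] in
/-- `tie` on an edge of `F`. -/
lemma tie_of_mem {e : E} (he : e ∈ F) (ω'' : Config ({e : E // e ∉ F} ⊕ Unit)) :
    tie F ω'' e = ω'' (Sum.inr ()) := by
  simp [tie, he]

omit [Fintype E] [Fintype V] [DecidableEq V] in
/-- `tie` on a free edge. -/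
lemma tie_of_not_mem {e : E} (he : e ∉ F) (ω'' : Config ({e : E // e ∉ F} ⊕ Unit)) :
    tie F ω'' e = ω'' (Sum.inl ⟨e, he⟩) := by
  simp [tie, he]

omit [Fintype E] [Fintype V] [DecidableEq V] in
/-- `tie` is monotone. -/
lemma tie_mono : Monotone (tie F) := by
  intro ω₁ ω₂ h e
  by_cases he : e ∈ F
  · rw [tie_of_mem F he, tie_of_mem F he]; exact h _
  · rw [tie_of_not_mem F he, tie_of_not_mem F he]; exact h _

omit [Fintype E] [Fintype V] [DecidableEq V] in
/-- `tie` commutes with the complement. -/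
lemma tie_compl (ω'' : Config ({e : E // e ∉ F} ⊕ Unit)) : tie F (compl ω'') = compl (tie F ω'') := by
  funext e
  by_cases he : e ∈ F
  · rw [tie_of_mem F he]; simp [compl, tie_of_mem F he]
  · rw [tie_of_not_mem F he]; simp [compl, tie_of_not_mem F he]

omit [Fintype E] [Fintype V] [DecidableEq V] in
/-- The image of `tie` is tied. -/
lemma tie_mem_tied (ω'' : Config ({e : E // e ∉ F} ⊕ Unit)) : tie F ω'' ∈ tied F := by
  intro e he e' he'
  rw [tie_of_mem F he, tie_of_mem F he']

omit [Fintype E] [Fintype V] [DecidableEq V] in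
/-- `tie` is injective when `F` is nonempty. -/
lemma tie_injective (hF : F.Nonempty) : Function.Injective (tie F) := by
  intro ω₁ ω₂ h
  funext i
  rcases i with ⟨e, he⟩ | u
  · have := congrFun h e
    rwa [tie_of_not_mem F he, tie_of_not_mem F he] at this
  · obtain ⟨e₁, he₁⟩ := hF
    have := congrFun h e₁
    rw [tie_of_mem F he₁, tie_of_mem F he₁] at this
    cases u
    exact this

omit [Fintype E] [Fintype V] [DecidableEq V] in
/-- Every tied configuration is in the image of `tie` (for `F` nonempty). -/
lemma exists_tie_eq (hF : F.Nonempty) {ω : Config E} (hω : ω ∈ tied F) :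
    ∃ ω'' : Config ({e : E // e ∉ F} ⊕ Unit), tie F ω'' = ω := by
  obtain ⟨e₁, he₁⟩ := hF
  refine ⟨fun i => match i with | Sum.inl ⟨e, _⟩ => ω e | Sum.inr _ => ω e₁, ?_⟩
  funext e
  by_cases he : e ∈ F
  · rw [tie_of_mem F he]
    exact hω e₁ he₁ e he
  · rw [tie_of_not_mem F he]

omit [Fintype V] [DecidableEq V] in
/-- A count is a cardinality. -/
lemma count_eq_card_tied (S : Set (Config E)) :
    count S = (Finset.univ.filter (fun ω : Config E => ω ∈ S)).card := by
  unfold count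
  rw [Finset.card_filter]

omit [Fintype V] [DecidableEq V] in
/-- The count of `S` on the tied sub-cube is the count of its pullback. -/
lemma count_inter_tied_eq (hF : F.Nonempty) (S : Set (Config E)) :
    count (S ∩ tied F) = count (tie F ⁻¹' S) := by
  rw [count_eq_card_tied, count_eq_card_tied]
  symm
  refine Finset.card_bij (fun ω'' _ => tie F ω'') ?_ ?_ ?_
  · intro ω'' h
    simp only [Finset.mem_filter, Finset.mem_univ, true_and, Set.mem_preimage] at h
    simp only [Finset.mem_filter, Finset.mem_univ, true_and, Set.mem_inter_iff]
    exact ⟨h, tie_mem_tied F ω''⟩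
  · intro a _ b _ h
    exact tie_injective F hF h
  · intro ω h
    simp only [Finset.mem_filter, Finset.mem_univ, true_and, Set.mem_inter_iff] at h
    obtain ⟨ω'', rfl⟩ := exists_tie_eq F hF h.2
    exact ⟨ω'', by simpa using h.1, rfl⟩

omit [Fintype E] [Fintype V] [DecidableEq V] in
/-- The pullback of the `bar` of a set is the `bar` of the pullback. -/
lemma preimage_bar (S : Set (Config E)) : tie F ⁻¹' bar S = bar (tie F ⁻¹' S) := by
  ext ω''
  simp only [Set.mem_preimage, mem_bar, tie_compl]

end Pullback

omit [Fintype V] in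
/-- **Harris on a tied sub-cube**: for `X ∩ Y = ∅` and any set `F` of edges,
`#{ω ∈ twoWorld A X B Y : ω constant on F} ≤ #{ω ∈ twoWorld (A ∪ B) ∅ ∅ (X ∪ Y) : ω constant on F}`. -/
theorem count_tied_le (F : Finset E) (A X B Y : Finset V) (hXY : X ∩ Y = ∅) :
    count (twoWorld ends s A X B Y ∩ tied F) ≤
      count (twoWorld ends s (A ∪ B) ∅ ∅ (X ∪ Y) ∩ tied F) := by
  rcases F.eq_empty_or_nonempty with rfl | hF
  · have htied : tied (∅ : Finset E) = Set.univ := by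
      ext ω; simp [tied]
    rw [htied, Set.inter_univ, Set.inter_univ]
    have h := rvdBK_of_disjoint ends s A X B Y hXY
    unfold RvdBK reimerCount at h
    rwa [hXY] at h
  rw [count_inter_tied_eq F hF, count_inter_tied_eq F hF]
  -- the regrouping of `rvdBK_of_disjoint`
  set QA := connAll ends s A with hQA
  set QB := connAll ends s B with hQB
  set RX := avoidAll ends s X with hRX
  set RY := avoidAll ends s Y with hRY
  have hW : twoWorld ends s A X B Y = (QA ∩ bar RY) ∩ bar (QB ∩ bar RX) := by
    unfold twoWorld
    rw [bar_inter, bar_inter, bar_bar]; ext ω; simp only [Set.mem_inter_iff]; tauto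
  have hR : twoWorld ends s (A ∪ B) ∅ ∅ (X ∪ Y) = (QA ∩ bar RY) ∩ (QB ∩ bar RX) := by
    unfold twoWorld
    rw [avoidAll_empty, connAll_empty, Set.inter_univ, Set.univ_inter, connAll_union, avoidAll_union,
      bar_inter]
    ext ω; simp only [Set.mem_inter_iff]; tauto
  have hU1 : IsUpperSet (QA ∩ bar RY) :=
    (isUpperSet_connAll ends s A).inter (isUpperSet_bar_of_isLowerSet (isLowerSet_avoidAll ends s Y))
  have hU2 : IsUpperSet (QB ∩ bar RX) :=
    (isUpperSet_connAll ends s B).inter (isUpperSet_bar_of_isLowerSet (isLowerSet_avoidAll ends s X))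
  rw [hW, hR]
  have e1 : tie F ⁻¹' ((QA ∩ bar RY) ∩ bar (QB ∩ bar RX)) =
      tie F ⁻¹' (QA ∩ bar RY) ∩ bar (tie F ⁻¹' (QB ∩ bar RX)) := by
    ext ω''
    simp only [Set.mem_preimage, Set.mem_inter_iff, mem_bar, tie_compl]
  have e2 : tie F ⁻¹' ((QA ∩ bar RY) ∩ (QB ∩ bar RX)) =
      tie F ⁻¹' (QA ∩ bar RY) ∩ tie F ⁻¹' (QB ∩ bar RX) := by
    ext ω''
    simp only [Set.mem_preimage, Set.mem_inter_iff]
  rw [e1, e2]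
  exact count_inter_bar_le_count_inter (hU1.preimage (tie_mono F)) (hU2.preimage (tie_mono F))

end ReimerVdBK
end Summit.Ventures.PercRepro2
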